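import Summits.ValiantsHypothesis.ValiantsHypothesis.Theorems.LacunarySymmetroidMatrixDescartesCensusRankCeiling

/-!
# `MatrixDescartes` census — DOOR A at `(3,4)`: the RANK-ONE-LETTER SECTOR — a `(3,4)` pencil with a letter of rank `≤ 1` has `≤ 15`
# positive det-roots, on EVERY support

HONEST FRAMING.  Object-search cell `pub-symmetroid`, door-A seat `val-sym-door-p3` (g10); beside the OPEN typed statement
`DoorA34 = PosRootLawAt 3 4 18` (route item `Theses.LacunarySymmetroid.DoorA34`, stmt-ValiantsHypothesis-19980), asserted nowhere.
The singular-letter sector (`Census.posRoots_le_18_of_det_letter_eq_zero`) caps a pencil with a rank-`≤ 2` letter at `18`; the rank ceiling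
(`Census.card_posRoots_succ_le_prod_rank_succ`, …CensusRankCeiling) only gives the product bound.  This file records the sharp count for a
RANK-`≤ 1` letter, for ALL real `3 × 3` letters and ALL exponent vectors (no Sidon hypothesis, symmetry not used):

* `support_det_pencil_subset_fibre` — the support of `det (∑ X^(d l) • S l)` is indexed by the column-to-letter maps `f : Fin 3 → Fin 4` whose
  fibre over `j` has at most `rank (S j)` elements (the tree's `det_colMap_eq_zero_of_rank_lt`, kept at the level of maps);
* `card_colMaps_multisets_fibre_le_one` — the maps with `#f⁻¹(j) ≤ 1` realise at most `16` multisets (`decide`), hence (`card_support_det_pencil_le_16_of_rank_le_one`)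
  at most `16` monomials: the `10` triple sums avoiding `j` and the `6` sums `d j + d a + d b`, `a, b ≠ j`;
* **`posRoots_le_15_of_rank_le_one`** — hence at most `15` distinct positive det-roots (sparse Descartes).

WHY THE CELL RECORDS IT (seat report HOME/DOOR-A34-P3G10-REPORT.md §2b): the census EIGHTEENS (0,1,4,N ≥ 342) have a TOP letter whose normalised
spectrum is `(−1.04, −2·10⁻²⁰, 1.4·10⁻¹⁷)` — rank ONE to twenty digits — yet carry `18` roots; the exact rank-2 compression of that letter still
carries `17` (…CensusDoorA34NullTopSeventeen), the rank-1 sector carries `≤ 15` (this file): the last `3` roots of the census maximum live entirely in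
the `10⁻¹⁷`-size rank-two/three corrections of the top letter — the graft/flag mechanism in sector language.  Nothing here bounds `ζ_sym(3,4)` on the
open stratum; `DoorA34` stays OPEN; nothing bears on `MatrixDescartes` (stmt-ValiantsHypothesis-18050) or `VP ≠ VNP`.
[folklore] Column multilinearity + rank + the sparse Descartes rule; elementary.
-/

-- `Summit.ValiantsHypothesis.ValiantsHypothesis.…` repeats a component by the D-0017 layout
-- (single-conjunct summit), which the `dupNamespace` linter flags; the name is mandated.
set_option linter.dupNamespace false

namespace Summit.ValiantsHypothesis.ValiantsHypothesis.Theorems.LacunarySymmetroidMatrixDescartes.Census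

open Polynomial Finset
open scoped BigOperators Polynomial Matrix

/-- **Support indexed by admissible column-to-letter maps.**  Every monomial of `det (∑ X^(d l) • S l)` is the exponent `∑ᵢ d (f i)` of some
map `f : Fin m → Fin K` whose fibre over `j` has at most `rank (S j)` elements. [folklore] -/
theorem support_det_pencil_subset_fibre {K m : ℕ} (d : Fin K → ℕ) (S : Fin K → Matrix (Fin m) (Fin m) ℝ) (j : Fin K) :
    (Matrix.det (∑ l, ((X : ℝ[X]) ^ d l) • (S l).map C)).support ⊆
      ((Finset.univ : Finset (Fin m → Fin K)).filter
          (fun f => (Finset.univ.filter (fun i => f i = j)).card ≤ (S j).rank)).image (fun f => ∑ i, d (f i)) := by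
  intro n hn
  rw [mem_support_iff, coeff_det_pencil_colMap] at hn
  obtain ⟨f, hf, hdet⟩ := Finset.exists_ne_zero_of_sum_ne_zero hn
  rw [Finset.mem_filter] at hf
  refine Finset.mem_image.2 ⟨f, Finset.mem_filter.2 ⟨Finset.mem_univ _, ?_⟩, hf.2⟩
  by_contra hlt
  exact hdet (det_colMap_eq_zero_of_rank_lt S f j (not_le.1 hlt))

/-- The column-to-letter maps `f : Fin 3 → Fin 4` taking at most ONE column from letter `j` realise at most `16` multisets of letters
(`10` avoiding `j`, `6` using it once). [folklore] -/
theorem card_colMaps_multisets_fibre_le_one (j : Fin 4) :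
    (((Finset.univ : Finset (Fin 3 → Fin 4)).filter (fun f => (Finset.univ.filter (fun i => f i = j)).card ≤ 1)).image
        (fun f => (Finset.univ.val.map f : Multiset (Fin 4)))).card ≤ 16 := by
  fin_cases j <;> decide

/-- **A rank-`≤ 1` letter leaves at most `16` monomials** (any real `3 × 3` letters, any exponents). [folklore] -/
theorem card_support_det_pencil_le_16_of_rank_le_one (d : Fin 4 → ℕ) (S : Fin 4 → Matrix (Fin 3) (Fin 3) ℝ) (j : Fin 4)
    (hj : (S j).rank ≤ 1) :
    (Matrix.det (∑ l, ((X : ℝ[X]) ^ d l) • (S l).map C)).support.card ≤ 16 := by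
  classical
  set A := (Finset.univ : Finset (Fin 3 → Fin 4)).filter (fun f => (Finset.univ.filter (fun i => f i = j)).card ≤ 1) with hA
  have hsub : (Matrix.det (∑ l, ((X : ℝ[X]) ^ d l) • (S l).map C)).support ⊆ A.image (fun f => ∑ i, d (f i)) := by
    refine (support_det_pencil_subset_fibre d S j).trans (Finset.image_subset_image ?_)
    intro f hf
    rw [Finset.mem_filter] at hf ⊢
    exact ⟨hf.1, hf.2.trans hj⟩
  -- the exponent factors through the multiset of letters
  have hfac : A.image (fun f => ∑ i, d (f i)) =
      (A.image (fun f => (Finset.univ.val.map f : Multiset (Fin 4)))).image (fun s => (s.map d).sum) := by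
    rw [Finset.image_image]
    refine Finset.image_congr fun f _ => ?_
    simp only [Function.comp_apply]
    exact StubDescartesCeiling.sum_eq_sym_sum d f
  have h16 := card_colMaps_multisets_fibre_le_one j
  calc (Matrix.det (∑ l, ((X : ℝ[X]) ^ d l) • (S l).map C)).support.card
      ≤ (A.image (fun f => ∑ i, d (f i))).card := Finset.card_le_card hsub
    _ = ((A.image (fun f => (Finset.univ.val.map f : Multiset (Fin 4)))).image (fun s => (s.map d).sum)).card := by rw [hfac]
    _ ≤ (A.image (fun f => (Finset.univ.val.map f : Multiset (Fin 4)))).card := Finset.card_image_le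
    _ ≤ 16 := h16

/-- **RANK-ONE-LETTER SECTOR: at most `15` distinct positive det-roots.**  If some letter of a `4`-term real `3 × 3` pencil has rank `≤ 1`
(e.g. `S j = σ • u uᵀ`), then `det (∑ X^(d l) • S l)` has at most `15` distinct positive roots — on every support, symmetric or not.  [folklore] -/
theorem posRoots_le_15_of_rank_le_one (d : Fin 4 → ℕ) (S : Fin 4 → Matrix (Fin 3) (Fin 3) ℝ) (j : Fin 4)
    (hj : (S j).rank ≤ 1) :
    ((Matrix.det (∑ l, ((X : ℝ[X]) ^ d l) • (S l).map C)).roots.toFinset.filter (fun t => 0 < t)).card ≤ 15 := by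
  by_cases hP : Matrix.det (∑ l, ((X : ℝ[X]) ^ d l) • (S l).map C) = 0
  · rw [hP, Polynomial.roots_zero, Multiset.toFinset_zero, Finset.filter_empty, Finset.card_empty]; omega
  have hlt := Literature.Computability.AlgebraicComplexity.card_roots_toFinset_filter_pos_lt_card_support hP
  have h16 := card_support_det_pencil_le_16_of_rank_le_one d S j hj
  omega

/-- The rank-one letter `σ • u uᵀ` has rank `≤ 1`. [folklore] -/
theorem rank_smul_vecMulVec_le_one (σ : ℝ) (u : Fin 3 → ℝ) : (σ • Matrix.vecMulVec u u).rank ≤ 1 :=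
  (rank_smul_le σ _).trans (Matrix.rank_vecMulVec_le u u)

/-- **Row currency**: a real symmetric `(3,4)` pencil one of whose letters is `σ • u uᵀ` has at most `15` distinct positive det-roots, on every
support (so a census maximiser's near-rank-one top letter carries its last three roots in the rank-two/three corrections). [folklore] -/
theorem posRoots_le_15_of_letter_eq_smul_vecMulVec (d : Fin 4 → ℕ) (S : Fin 4 → Matrix (Fin 3) (Fin 3) ℝ) (j : Fin 4)
    (σ : ℝ) (u : Fin 3 → ℝ) (hj : S j = σ • Matrix.vecMulVec u u) :
    ((Matrix.det (∑ l, ((X : ℝ[X]) ^ d l) • (S l).map C)).roots.toFinset.filter (fun t => 0 < t)).card ≤ 15 :=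
  posRoots_le_15_of_rank_le_one d S j (by rw [hj]; exact rank_smul_vecMulVec_le_one σ u)

end Summit.ValiantsHypothesis.ValiantsHypothesis.Theorems.LacunarySymmetroidMatrixDescartes.Census
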